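import Summits.CriticalPhenomena.PercolationContinuityZ3.Theorems.PercNearOneGluingNoHeavyLowerTailCILObserverBlocksTools
import HarnessLib

/-!
# `NoHeavyLowerTail` (stmt-CriticalPhenomena-4575) — the T-form is closed under gluing instances at the observer

Support file (prover `prim-hp-5`, technique "blob-quotient induction"; `--supports
stmt-CriticalPhenomena-4575`).  No definitions, no named facts, no sorries.

`μ = prodBernoulli w` on `Fin n`, relays `A`, observer `o ∉ A`, level `j`; everything read inside a vertex set
`W ∋ o`; `N = |{x ∈ A : o ↔ x}|`, `π(c) = {x ∈ A : c ↔ x}`; T-form `T(W, o, c) : μ{1 ≤ N ≤ j} ≤ μ{1 ≤ N ∧ |π(c)| ≤ j}`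
(⇒ `μ{1 ≤ N ≤ j} ≤ μ{1 ≤ N}·μ{|π(c)| ≤ j}` by Harris ⇒ CIL).

**Theorem `CutObserver.SteinerPorts.Blocks.tform_blocks` (block gluing).**  Let `W ∖ o` be covered by
pairwise disjoint, pairwise non-adjacent blocks `V l` — i.e. `o` is a cut vertex of the positive pairs inside
`W`, with ARBITRARILY MANY pairs from `o` into each block.  If every block holding a relay has a relay
`a l ∈ V l` with `T(insert o (V l), o, a l)`, and `i` maximises `t_l = μ{|π_{insert o (V l)}(a l)| ≤ j}` over such
blocks, then `T(W, o, a i)`.  So the T-form at an observer is decided block by block: the set of graphs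
satisfying it at `o` is closed under gluing at `o`.  (`CutObserver.SteinerPorts.tform_transfer` of
`…CILCutObserverSteiner` is the case of single-pair blocks followed by the one-block transfer through a Steiner
port; `Theorems.cumulativeIsolation_cutObserver` the case of single-pair blocks with relay ports.)
Proof, three cells: on `{a i ↔ o inside its block}` the clusters of `o` and `a i` coincide; on `{N_i = 0}` the
minority event needs another block with `1 ≤ N_l`, all such blocks light, of probability
`∏_{l≠i} μ{N_l ≤ j} − ∏_{l≠i} μ{N_l = 0} ≤ t·(1 − ∏_{l≠i} μ{N_l = 0})` (telescoping `CutObserver.prod_sub_prod_le`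
after `μ{1 ≤ N_l ≤ j} ≤ μ{1 ≤ N_l}·t_l`, the block T-form followed by Harris), against
`μ({N_i = 0} ∩ {|π_i(a i)| ≤ j}) ≥ μ{N_i = 0}·t` (Harris, two decreasing events) times the same attachment
probability; on `{N_i ≥ 1} ∖ {a i ↔ o}` it is the two-cluster part of the block T-form of block `i`.
Numerics (exact DP, this seat, lab/blockglue.py): 0 violations in 2 387 (glued instance, block-witness choice)
pairs, `n ≤ 9`.
-/

noncomputable section

namespace Summit.CriticalPhenomena.PercolationContinuityZ3.Theorems

open MeasureTheory Set Literature.Probability.LatticeModels Literature.Probability.Percolation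
open scoped Classical BigOperators

variable {n : ℕ}

namespace CutObserver

namespace SteinerPorts

namespace Blocks

/-- **Block gluing of the T-form at the observer.**  Inside `W ∋ o`, let `W ∖ o` be covered by pairwise
disjoint, pairwise non-adjacent blocks `V l` (the observer's own pairs into the blocks are ARBITRARY); each
block carries `a l ∈ V l`; a block with `a l ∉ A` holds no relay, and a block with `a l ∈ A` satisfies the
T-form of the block instance read inside `insert o (V l)`:
`μ{1 ≤ N_l ≤ j} ≤ μ{1 ≤ N_l ∧ |π_l(a l)| ≤ j}`.  If `i` is a live block maximising `μ{|π_l(a l)| ≤ j}` among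
live blocks, then the T-form holds at `o` inside `W` with witness `a i`.  (Three cells: `a i ↔ o` inside its
block — the clusters coincide; `N_i = 0` — telescoping `CutObserver.prod_sub_prod_le` over the other blocks
with `μ{1 ≤ N_l ≤ j} ≤ μ{1 ≤ N_l}·t_l` (block T-form + Harris) against Harris for the two decreasing events
`{N_i = 0}`, `{|π_i(a i)| ≤ j}`; `N_i ≥ 1` off `a i ↔ o` — the two-cluster part of the block T-form.)
[folklore] -/
theorem tform_blocks (w : Sym2 (Fin n) → unitInterval) (A W : Finset (Fin n)) (o : Fin n) (j : ℕ)
    {d : ℕ} (V : Fin d → Finset (Fin n)) (a : Fin d → Fin n) (i : Fin d)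
    (hoA : o ∉ A) (haV : ∀ l, a l ∈ V l) (hoV : ∀ l, o ∉ V l)
    (hdisj : ∀ l l', l ≠ l' → Disjoint (V l) (V l'))
    (hoW : o ∈ W) (hVW : ∀ l, V l ⊆ W) (hcover : ∀ v ∈ W, v ≠ o → ∃ l, v ∈ V l)
    (hsep : ∀ l l', l ≠ l' → ∀ u ∈ V l, ∀ v ∈ V l', w s(u, v) = 0)
    (hdead : ∀ l, a l ∉ A → ∀ x ∈ V l, x ∉ A)
    (hT : ∀ l, a l ∈ A →
      (prodBernoulli w).real {ω : BondConfig (Fin n) |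
          1 ≤ (A.filter fun x => (openGraph (ω ∩ ↑((insert o (V l)).sym2))).Reachable o x).card ∧
            (A.filter fun x => (openGraph (ω ∩ ↑((insert o (V l)).sym2))).Reachable o x).card ≤ j} ≤
        (prodBernoulli w).real {ω : BondConfig (Fin n) |
          1 ≤ (A.filter fun x => (openGraph (ω ∩ ↑((insert o (V l)).sym2))).Reachable o x).card ∧
            (A.filter fun x => (openGraph (ω ∩ ↑((insert o (V l)).sym2))).Reachable (a l) x).card ≤ j})
    (hi : a i ∈ A)
    (himax : ∀ l, a l ∈ A →
      (prodBernoulli w).real {ω : BondConfig (Fin n) |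
          (A.filter fun x => (openGraph (ω ∩ ↑((insert o (V l)).sym2))).Reachable (a l) x).card ≤ j} ≤
        (prodBernoulli w).real {ω : BondConfig (Fin n) |
          (A.filter fun x => (openGraph (ω ∩ ↑((insert o (V i)).sym2))).Reachable (a i) x).card ≤ j}) :
    (prodBernoulli w).real {ω : BondConfig (Fin n) |
        1 ≤ (A.filter fun x => (openGraph (ω ∩ ↑(W.sym2))).Reachable o x).card ∧
          (A.filter fun x => (openGraph (ω ∩ ↑(W.sym2))).Reachable o x).card ≤ j} ≤
      (prodBernoulli w).real {ω : BondConfig (Fin n) |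
        1 ≤ (A.filter fun x => (openGraph (ω ∩ ↑(W.sym2))).Reachable o x).card ∧
          (A.filter fun x => (openGraph (ω ∩ ↑(W.sym2))).Reachable (a i) x).card ≤ j} := by
  haveI : IsProbabilityMeasure (prodBernoulli w) := inferInstance
  -- ### read every block through its loop-free pair set (pairwise disjoint supports)
  set S : Fin d → Finset (Sym2 (Fin n)) := fun l => (insert o (V l)).sym2.erase s(o, o) with hS
  have hopen : ∀ l (ω : BondConfig (Fin n)),
      openGraph (ω ∩ ↑((insert o (V l)).sym2)) = openGraph (ω ∩ ↑(S l)) :=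
    fun l ω => (openGraph_inter_erase_loop ω (insert o (V l)) o).symm
  simp only [hopen] at hT himax
  -- ### notation
  set Nl : Fin d → BondConfig (Fin n) → ℕ := fun l ω =>
    (A.filter fun x => (openGraph (ω ∩ ↑(S l))).Reachable o x).card with hNl
  set Ll : Fin d → BondConfig (Fin n) → ℕ := fun l ω =>
    (A.filter fun x => (openGraph (ω ∩ ↑(S l))).Reachable (a l) x).card with hLl
  set N : BondConfig (Fin n) → ℕ := fun ω =>
    (A.filter fun x => (openGraph (ω ∩ ↑(W.sym2))).Reachable o x).card with hN
  set Lc : BondConfig (Fin n) → ℕ := fun ω =>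
    (A.filter fun x => (openGraph (ω ∩ ↑(W.sym2))).Reachable (a i) x).card with hLc
  set L := {ω : BondConfig (Fin n) | 1 ≤ N ω ∧ N ω ≤ j} with hL
  set R := {ω : BondConfig (Fin n) | 1 ≤ N ω ∧ Lc ω ≤ j} with hR
  change (prodBernoulli w).real L ≤ (prodBernoulli w).real R
  set ul : Fin d → ℝ := fun l => (prodBernoulli w).real {ω : BondConfig (Fin n) | 1 ≤ Nl l ω} with hul
  set sl : Fin d → ℝ := fun l => (prodBernoulli w).real {ω : BondConfig (Fin n) | Nl l ω ≤ j} with hsl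
  set t : ℝ := (prodBernoulli w).real {ω : BondConfig (Fin n) | Ll i ω ≤ j} with ht
  set U := {ω : BondConfig (Fin n) | (openGraph (ω ∩ ↑(S i))).Reachable (a i) o} with hU
  set Z := {ω : BondConfig (Fin n) | ¬ 1 ≤ Nl i ω} with hZ
  set Bt := {ω : BondConfig (Fin n) | Ll i ω ≤ j} with hBt
  set Y : Fin d → Set (BondConfig (Fin n)) := fun l => {ω | 1 ≤ Nl l ω} with hY
  set NF : Fin d → Set (BondConfig (Fin n)) := fun l => {ω | Nl l ω ≤ j} with hNF
  set G := {ω : BondConfig (Fin n) | ∀ e ∈ ω, w e ≠ 0} with hG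
  set T := Finset.univ.erase i with hT'
  -- ### pointwise geometry on the support event
  have hBW : ∀ l, insert o (V l) ⊆ W := fun l => Finset.insert_subset hoW (hVW l)
  have hreachN : ∀ ω ∈ G, ∀ x ∈ A, (openGraph (ω ∩ ↑(W.sym2))).Reachable o x ↔
      ∃ l, (openGraph (ω ∩ ↑(S l))).Reachable o x := by
    intro ω hω x hx
    have h := reach_observer_iff w W o V hoW hVW hcover hsep ω hω x
    simp only [hopen] at h
    rw [h]
    have hxo : x ≠ o := fun h => hoA (h ▸ hx)
    simp only [hxo, false_or]
  have hNlle : ∀ ω l, Nl l ω ≤ N ω := by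
    intro ω l
    refine Finset.card_le_card fun x hx => ?_
    rw [Finset.mem_filter] at hx ⊢
    refine ⟨hx.1, ?_⟩
    have h := hx.2
    rw [← hopen] at h
    exact reachable_restrict_mono (hBW l) h
  have hNpos : ∀ ω ∈ G, 1 ≤ N ω ↔ ∃ l, 1 ≤ Nl l ω := by
    intro ω hω
    constructor
    · intro h1
      obtain ⟨x, hx⟩ := Finset.card_pos.1 h1
      rw [Finset.mem_filter] at hx
      obtain ⟨l, hreach⟩ := (hreachN ω hω x hx.1).1 hx.2
      exact ⟨l, Finset.card_pos.2 ⟨x, Finset.mem_filter.2 ⟨hx.1, hreach⟩⟩⟩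
    · rintro ⟨l, h1⟩
      exact le_trans h1 (hNlle ω l)
  have hLcLl : ∀ ω ∈ G, ω ∉ U → Lc ω = Ll i ω := by
    intro ω hω hUω
    have hnot : ¬ (openGraph (ω ∩ ↑((insert o (V i)).sym2))).Reachable (a i) o := by
      rw [hopen]; exact hUω
    simp only [hLc, hLl]
    congr 1
    refine Finset.filter_congr fun x _ => ?_
    rw [reach_block_iff w W o V hoV hoW hVW hcover hsep ω hω i (haV i) hnot x, hopen]
  have hLcN : ∀ ω, ω ∈ U → Lc ω = N ω := by
    intro ω hUω
    have hao : (openGraph (ω ∩ ↑(W.sym2))).Reachable (a i) o := by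
      have h : (openGraph (ω ∩ ↑(S i))).Reachable (a i) o := hUω
      rw [← hopen] at h
      exact reachable_restrict_mono (hBW i) h
    simp only [hLc, hN]
    congr 1
    exact Finset.filter_congr fun x _ => ⟨fun h => hao.symm.trans h, fun h => hao.trans h⟩
  have hUN : ∀ ω, ω ∈ U → Nl i ω = Ll i ω ∧ 1 ≤ Nl i ω := by
    intro ω hUω
    have hUω' : (openGraph (ω ∩ ↑(S i))).Reachable (a i) o := hUω
    constructor
    · simp only [hNl, hLl]
      congr 1
      exact Finset.filter_congr fun x _ => ⟨fun h => hUω'.trans h, fun h => hUω'.symm.trans h⟩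
    · exact Finset.card_pos.2 ⟨a i, Finset.mem_filter.2 ⟨hi, hUω'.symm⟩⟩
  have hZU : ∀ ω, ω ∈ Z → ω ∉ U := fun ω hZω hUω => hZω (hUN ω hUω).2
  have hNdead : ∀ l, a l ∉ A → ∀ ω, Nl l ω = 0 := by
    intro l hl ω
    refine Finset.card_eq_zero.2 (Finset.filter_eq_empty_iff.2 fun x hx hreach => ?_)
    have h := hreach
    rw [← hopen] at h
    have hxB : x ∈ insert o (V l) := mem_of_reachable_restrict (Finset.mem_insert_self _ _) h
    rcases Finset.mem_insert.1 hxB with hxo | hxV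
    · exact hoA (hxo ▸ hx)
    · exact hdead l hl x hxV hx
  have hYup : ∀ l, IsUpperSet {ω : BondConfig (Fin n) | 1 ≤ Nl l ω} := fun l ω ω' hle h =>
    le_trans h (Finset.card_le_card fun x hx => by
      rw [Finset.mem_filter] at hx ⊢
      exact ⟨hx.1, reachable_mono (inter_subset_inter_left _ hle) hx.2⟩)
  have hLllow : ∀ l, IsLowerSet {ω : BondConfig (Fin n) | Ll l ω ≤ j} := fun l ω ω' hle h =>
    le_trans (Finset.card_le_card fun x hx => by
      rw [Finset.mem_filter] at hx ⊢
      exact ⟨hx.1, reachable_mono (inter_subset_inter_left _ hle) hx.2⟩) h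
  have hZlow : IsLowerSet Z := fun ω ω' hle h h1 => h (hYup i hle h1)
  -- ### scalars
  have ht0 : 0 ≤ t := measureReal_nonneg; have ht1 : t ≤ 1 := measureReal_le_one
  have hu0 : ∀ l, 0 ≤ ul l := fun l => measureReal_nonneg; have hu1 : ∀ l, ul l ≤ 1 := fun l => measureReal_le_one
  have hs0 : ∀ l, 0 ≤ sl l := fun l => measureReal_nonneg
  -- `b_l = s_l + u_l - 1 ≤ u_l · t`: block T-form, Harris, maximality (dead blocks: `b_l = 0`)
  have hbl : ∀ l, sl l + ul l - 1 ≤ ul l * t := by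
    intro l
    rw [← measureReal_one_le_and_le w (Nl l) j]
    by_cases hl : a l ∈ A
    · calc (prodBernoulli w).real {ω : BondConfig (Fin n) | 1 ≤ Nl l ω ∧ Nl l ω ≤ j}
          ≤ (prodBernoulli w).real ({ω : BondConfig (Fin n) | 1 ≤ Nl l ω} ∩ {ω | Ll l ω ≤ j}) := hT l hl
        _ ≤ (prodBernoulli w).real {ω : BondConfig (Fin n) | 1 ≤ Nl l ω} *
              (prodBernoulli w).real {ω : BondConfig (Fin n) | Ll l ω ≤ j} :=
            prodBernoulli_harris_upper_lower w (hYup l) (hLllow l) MeasurableSet.of_discrete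
              MeasurableSet.of_discrete
        _ ≤ ul l * t := mul_le_mul_of_nonneg_left (himax l hl) (hu0 l)
    · have h0 : {ω : BondConfig (Fin n) | 1 ≤ Nl l ω ∧ Nl l ω ≤ j} = ∅ := by
        ext ω
        simp only [mem_setOf_eq, mem_empty_iff_false, iff_false, not_and]
        intro h1
        have := hNdead l hl ω
        omega
      rw [h0, measureReal_empty]
      exact mul_nonneg (hu0 l) ht0
  -- ### the telescoping bound
  set D : ℝ := 1 - ∏ l ∈ T, (1 - ul l) with hD
  have hD0 : 0 ≤ D := by
    have : ∏ l ∈ T, (1 - ul l) ≤ 1 :=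
      Finset.prod_le_one (fun l _ => by linarith [hu1 l]) fun l _ => by linarith [hu0 l]
    linarith
  have htel : ∏ l ∈ T, sl l - ∏ l ∈ T, (1 - ul l) ≤ t * D := by
    have hstep : ∏ l ∈ T, sl l ≤ ∏ l ∈ T, (1 - ul l + ul l * t) :=
      Finset.prod_le_prod (fun l _ => hs0 l) fun l _ => by linarith [hbl l]
    have h := prod_sub_prod_le T ul (fun _ => t) t (fun l _ => hu0 l) (fun l _ => hu1 l)
      (fun _ _ => ht0) (fun _ _ => le_rfl) ht1
    rw [hD]
    linarith
  -- ### supports, independence, values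
  have hSdisj : (↑T : Set (Fin d)).PairwiseDisjoint S :=
    fun k _ k' _ hkk' => blockSupports_disjoint o V hdisj hkk'
  have hsub_i : (↑(S i) : Set (Sym2 (Fin n))) ⊆ (⋃ l ∈ T, (↑(S l) : Set (Sym2 (Fin n))))ᶜ := by
    intro e he
    simp only [mem_compl_iff, mem_iUnion, Finset.mem_coe, not_exists]
    intro l hl hel
    exact Finset.disjoint_left.1 (blockSupports_disjoint o V hdisj
      (Ne.symm (Finset.mem_erase.1 hl).1)) (Finset.mem_coe.1 he) hel
  have hNF_det : ∀ l ∈ T, DeterminedBy (NF l) (↑(S l) : Set (Sym2 (Fin n))) := fun l _ =>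
    determinedBy_inter (S l) (fun ξ => (A.filter fun x => (openGraph ξ).Reachable o x).card ≤ j)
  have hYc_det : ∀ l ∈ T, DeterminedBy (Y l)ᶜ (↑(S l) : Set (Sym2 (Fin n))) := fun l _ =>
    determinedBy_inter (S l) (fun ξ => ¬ 1 ≤ (A.filter fun x => (openGraph ξ).Reachable o x).card)
  have hYcNF : ∀ l ∈ T, (Y l)ᶜ ⊆ NF l := by
    intro l _ ω hω
    have hω' : ¬ 1 ≤ Nl l ω := hω
    show Nl l ω ≤ j
    omega
  have hNFval : ∏ l ∈ T, (prodBernoulli w).real (NF l) = ∏ l ∈ T, sl l :=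
    Finset.prod_congr rfl fun l _ => rfl
  have hYcval : ∏ l ∈ T, (prodBernoulli w).real (Y l)ᶜ = ∏ l ∈ T, (1 - ul l) := by
    refine Finset.prod_congr rfl fun l _ => ?_
    rw [measureReal_compl MeasurableSet.of_discrete, probReal_univ]
  -- ### cell `N_i = 0`
  have hP2 : (prodBernoulli w).real ((L \ U) ∩ Z) ≤ (prodBernoulli w).real ((R \ U) ∩ Z) := by
    have hdet : DeterminedBy Z (↑(S i) : Set (Sym2 (Fin n))) :=
      determinedBy_inter (S i) (fun ξ => ¬ 1 ≤ (A.filter fun x => (openGraph ξ).Reachable o x).card)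
    have hdetB : DeterminedBy (Z ∩ Bt) (↑(S i) : Set (Sym2 (Fin n))) :=
      determinedBy_inter (S i) (fun ξ => ¬ 1 ≤ (A.filter fun x => (openGraph ξ).Reachable o x).card ∧
        (A.filter fun x => (openGraph ξ).Reachable (a i) x).card ≤ j)
    have hsubL : (L ∩ Z) ∩ G ⊆ (Z ∩ ⋂ l ∈ T, NF l) \ (Z ∩ ⋂ l ∈ T, (Y l)ᶜ) := by
      rintro ω ⟨⟨⟨h1, hj⟩, hZω⟩, hωG⟩
      refine ⟨⟨hZω, mem_biInter fun l _ => le_trans (hNlle ω l) hj⟩, fun hall => ?_⟩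
      obtain ⟨l, h1l⟩ := (hNpos ω hωG).1 h1
      have hli : l ≠ i := by
        rintro rfl
        exact hZω h1l
      exact (mem_iInter₂.1 hall.2) l (Finset.mem_erase.2 ⟨hli, Finset.mem_univ _⟩) h1l
    have hsubR : ((Z ∩ Bt) \ ((Z ∩ Bt) ∩ ⋂ l ∈ T, (Y l)ᶜ)) ∩ G ⊆ R ∩ Z := by
      rintro ω ⟨⟨⟨hZω, hBω⟩, hnot⟩, hωG⟩
      have h1 : 1 ≤ N ω := by
        have hnot' : ω ∉ ⋂ l ∈ T, (Y l)ᶜ := fun h => hnot ⟨⟨hZω, hBω⟩, h⟩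
        simp only [mem_iInter, not_forall, mem_compl_iff, not_not] at hnot'
        obtain ⟨l, -, hl⟩ := hnot'
        exact (hNpos ω hωG).2 ⟨l, hl⟩
      refine ⟨⟨h1, ?_⟩, hZω⟩
      rw [hLcLl ω hωG (hZU ω hZω)]
      exact hBω
    have hHarris : (prodBernoulli w).real Z * t ≤ (prodBernoulli w).real (Z ∩ Bt) :=
      prodBernoulli_harris_lower w hZlow (hLllow i) MeasurableSet.of_discrete MeasurableSet.of_discrete
    have e1 : (L \ U) ∩ Z = L ∩ Z := by
      ext ω
      simp only [mem_inter_iff, mem_sdiff]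
      exact ⟨fun ⟨⟨hL', _⟩, hZ'⟩ => ⟨hL', hZ'⟩, fun ⟨hL', hZ'⟩ => ⟨⟨hL', hZU ω hZ'⟩, hZ'⟩⟩
    have e2 : (R \ U) ∩ Z = R ∩ Z := by
      ext ω
      simp only [mem_inter_iff, mem_sdiff]
      exact ⟨fun ⟨⟨hR', _⟩, hZ'⟩ => ⟨hR', hZ'⟩, fun ⟨hR', hZ'⟩ => ⟨⟨hR', hZU ω hZ'⟩, hZ'⟩⟩
    rw [e1, e2]
    calc (prodBernoulli w).real (L ∩ Z)
        = (prodBernoulli w).real ((L ∩ Z) ∩ G) := (measureReal_inter_support w _).symm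
      _ ≤ (prodBernoulli w).real ((Z ∩ ⋂ l ∈ T, NF l) \ (Z ∩ ⋂ l ∈ T, (Y l)ᶜ)) :=
          measureReal_mono hsubL (measure_ne_top _ _)
      _ = (prodBernoulli w).real Z * (∏ l ∈ T, sl l - ∏ l ∈ T, (1 - ul l)) := by
          rw [measureReal_prodEvents_sdiff w T S hSdisj NF (fun l => (Y l)ᶜ) hNF_det hYc_det hYcNF Z
            (hdet.mono hsub_i), hNFval, hYcval]
      _ ≤ (prodBernoulli w).real Z * (t * D) := mul_le_mul_of_nonneg_left htel measureReal_nonneg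
      _ ≤ (prodBernoulli w).real (Z ∩ Bt) * D := by
          rw [← mul_assoc]; exact mul_le_mul_of_nonneg_right hHarris hD0
      _ = (prodBernoulli w).real ((Z ∩ Bt) \ ((Z ∩ Bt) ∩ ⋂ l ∈ T, (Y l)ᶜ)) := by
          rw [measureReal_attach w T S hSdisj (fun l => (Y l)ᶜ) hYc_det (Z ∩ Bt) (hdetB.mono hsub_i),
            hYcval]
      _ = (prodBernoulli w).real (((Z ∩ Bt) \ ((Z ∩ Bt) ∩ ⋂ l ∈ T, (Y l)ᶜ)) ∩ G) :=
          (measureReal_inter_support w _).symm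
      _ ≤ (prodBernoulli w).real (R ∩ Z) := measureReal_mono hsubR (measure_ne_top _ _)
  -- ### cell `N_i ≥ 1`, witness off the observer's block cluster: two-cluster part of the block T-form
  have hP3 : (prodBernoulli w).real ((L \ U) \ Z) ≤ (prodBernoulli w).real ((R \ U) \ Z) := by
    set EL := {ω : BondConfig (Fin n) | ω ∉ U ∧ (1 ≤ Nl i ω ∧ Nl i ω ≤ j)} with hEL
    set ER := {ω : BondConfig (Fin n) | ω ∉ U ∧ (1 ≤ Nl i ω ∧ Ll i ω ≤ j)} with hER
    have hsubL : ((L \ U) \ Z) ∩ G ⊆ EL := by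
      rintro ω ⟨⟨⟨hωL, hUω⟩, hZω⟩, -⟩
      exact ⟨hUω, not_not.1 hZω, le_trans (hNlle ω i) hωL.2⟩
    have hsubR : ER ∩ G ⊆ (R \ U) \ Z := by
      rintro ω ⟨⟨hUω, h1, hB⟩, hωG⟩
      refine ⟨⟨⟨le_trans h1 (hNlle ω i), ?_⟩, hUω⟩, fun h => h h1⟩
      rw [hLcLl ω hωG hUω]
      exact hB
    have hELER : (prodBernoulli w).real EL ≤ (prodBernoulli w).real ER := by
      have hTi := hT i hi
      have hsplitL := measureReal_inter_add_sdiff (μ := prodBernoulli w)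
        (s := {ω : BondConfig (Fin n) | 1 ≤ Nl i ω ∧ Nl i ω ≤ j}) (MeasurableSet.of_discrete (s := U))
        (measure_ne_top _ _)
      have hsplitR := measureReal_inter_add_sdiff (μ := prodBernoulli w)
        (s := {ω : BondConfig (Fin n) | 1 ≤ Nl i ω ∧ Ll i ω ≤ j}) (MeasurableSet.of_discrete (s := U))
        (measure_ne_top _ _)
      have heqU : ({ω : BondConfig (Fin n) | 1 ≤ Nl i ω ∧ Nl i ω ≤ j} ∩ U) =
          ({ω : BondConfig (Fin n) | 1 ≤ Nl i ω ∧ Ll i ω ≤ j} ∩ U) := by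
        ext ω
        simp only [mem_inter_iff, mem_setOf_eq]
        constructor
        · rintro ⟨⟨h1, hj⟩, hU⟩; exact ⟨⟨h1, (hUN ω hU).1 ▸ hj⟩, hU⟩
        · rintro ⟨⟨h1, hj⟩, hU⟩; exact ⟨⟨h1, (hUN ω hU).1.symm ▸ hj⟩, hU⟩
      have hdL : ({ω : BondConfig (Fin n) | 1 ≤ Nl i ω ∧ Nl i ω ≤ j} \ U) = EL := by
        ext ω; simp only [mem_sdiff, mem_setOf_eq, hEL]; tauto
      have hdR : ({ω : BondConfig (Fin n) | 1 ≤ Nl i ω ∧ Ll i ω ≤ j} \ U) = ER := by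
        ext ω; simp only [mem_sdiff, mem_setOf_eq, hER]; tauto
      rw [heqU, hdL] at hsplitL
      rw [hdR] at hsplitR
      linarith
    calc (prodBernoulli w).real ((L \ U) \ Z)
        = (prodBernoulli w).real (((L \ U) \ Z) ∩ G) := (measureReal_inter_support w _).symm
      _ ≤ (prodBernoulli w).real EL := measureReal_mono hsubL (measure_ne_top _ _)
      _ ≤ (prodBernoulli w).real ER := hELER
      _ = (prodBernoulli w).real (ER ∩ G) := (measureReal_inter_support w _).symm
      _ ≤ (prodBernoulli w).real ((R \ U) \ Z) := measureReal_mono hsubR (measure_ne_top _ _)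
  -- ### cell `a i ↔ o` inside its block: the two clusters coincide
  have hP0 : (prodBernoulli w).real (L ∩ U) ≤ (prodBernoulli w).real (R ∩ U) := by
    refine measureReal_mono (fun ω hω => ?_) (measure_ne_top _ _)
    obtain ⟨⟨h1, hj⟩, hUω⟩ := hω
    refine ⟨⟨h1, ?_⟩, hUω⟩
    rw [hLcN ω hUω]
    exact hj
  -- ### assemble
  have hL1 := measureReal_inter_add_sdiff (μ := prodBernoulli w) (s := L)
    (MeasurableSet.of_discrete (s := U)) (measure_ne_top _ _)
  have hR1 := measureReal_inter_add_sdiff (μ := prodBernoulli w) (s := R)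
    (MeasurableSet.of_discrete (s := U)) (measure_ne_top _ _)
  have hL2 := measureReal_inter_add_sdiff (μ := prodBernoulli w) (s := L \ U)
    (MeasurableSet.of_discrete (s := Z)) (measure_ne_top _ _)
  have hR2 := measureReal_inter_add_sdiff (μ := prodBernoulli w) (s := R \ U)
    (MeasurableSet.of_discrete (s := Z)) (measure_ne_top _ _)
  linarith

end Blocks

end SteinerPorts

end CutObserver

end Summit.CriticalPhenomena.PercolationContinuityZ3.Theorems

end
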